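import Summits.HubbardSuperconductivity.HubbardSuperconductivity.Theorems.BcsKacWindowCoherenceWindowLROSharpTransfer

/-!
# PROPOSED line skeleton `kato-window` for crux `CoherenceWindowLRO` (stmt-HubbardSuperconductivity-1319)

Written by the lead of line `birth` (prover-line-stmt-HubbardSuperconductivity-1319-c16-0, session 2) as a
RECOMMENDATION to crux-plan — not a filed line (leads do not file lines). One stub, the finite-volume source-free
engine output in Temple/gap form; the composition is the LANDED theorem
`Summit.HubbardSuperconductivity.HubbardSuperconductivity.Theorems.BcsKacWindow.coherenceWindowLRO_of_gapForms`
(p156808). `lean check`: rc 0, sorries 1 (= the stub), `CoherenceWindowLRO_of` concludes the crux BY NAME.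

Honesty note: the stub is NOT known to be implied by the crux (it asserts approximate-eigenvector structure
`‖Δ_d†Δ_d w‖ ≤ (α+β)‖w‖` and a located sector energy), so it is a genuine strengthening along the intended proof;
its parallelogram sibling (hypothesis of `coherenceWindowLRO_of_lowEnergySubspaces`) is crux-EQUIVALENT
(`coherenceWindowLRO_iff_lowEnergySubspaces`, p156924). Either way the stub is the programme of
stmt-HubbardSuperconductivity-2010 in finite volume: `Leans on: stmt-2010 (open)`, co-requisite stmt-0158, and the
refuters' F1 restatement (Δ per doping) should be applied to the crux first.
-/

set_option linter.dupNamespace false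

namespace Summit.HubbardSuperconductivity.HubbardSuperconductivity.Cruxes.CoherenceWindowLRO.KatoWindow

open Summit.HubbardSuperconductivity.HubbardSuperconductivity.Theses.BcsKacWindow (CoherenceWindowLRO)
open Matrix Literature.MathematicalPhysics.QuantumLattice
open Summit.HubbardSuperconductivity.HubbardSuperconductivity.Theorems.BcsKacWindow

/-- **STUB — `stub_gapForms` (the engine output, Temple form).** With a doping window, flat-in-`U` gap pins and
`c₀, s₀ > 0`: for every window top `s ≥ s₀` there is `U₁ > 0` such that every window torus sector
`K = szSector N 0` of `H = hubbardTorus 2 L 1 U` carries a subspace `W ≤ K`, a level `E₀`, a gap `γ > 0`, a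
resolution `η` with `64η ≤ γ`, and order constants `0 ≤ β ≤ α`, `α ≥ 4c₀Δ(U)²L⁴`, with: a unit trial vector of `K`
of energy `≤ E₀ + η`; the operator lower bound `H|_K ≥ E₀ + γ(1 - P_W)` on orthogonal pairs; `d_{x²-y²}` pair
order `Re⟨w, Δ_d†Δ_d w⟩ ≥ α‖w‖²` and `‖Δ_d†Δ_d w‖ ≤ (α+β)‖w‖` on `W`.
Why plausibly true: `W` = dressed number-projected `d`-wave BCS sector vector + nodal band, `γ ≍ Δ(U)/s`
(pair-momentum modes on a torus of side `≤ s/Δ(U)`), `η` = precision of a multiscale construction below the gap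
scale at fixed `s`, `α ≍ (N(0)Δ log(W/Δ))²L⁴`, `β/α ≍ (N(0)/(α₀ΔL²))^{1/2} → 0`.
Size: XL = the T = 0 weak-coupling engine below `WeakCouplingCeiling` (stmt-HubbardSuperconductivity-2010) in
finite-volume source-free form. -/
theorem stub_gapForms :
    ∃ (a b κ₁ κ₂ c₀ s₀ : ℝ) (Δ : ℝ → ℝ), 0 < a ∧ a < b ∧ b < 1 / 2 ∧ 0 < κ₁ ∧ κ₁ ≤ κ₂ ∧
      0 < c₀ ∧ 0 < s₀ ∧
      (∀ U : ℝ, 0 < U → Real.exp (-(κ₂ / U ^ 2)) ≤ Δ U ∧ Δ U ≤ Real.exp (-(κ₁ / U ^ 2))) ∧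
      ∀ s : ℝ, s₀ ≤ s → ∃ U₁ : ℝ, 0 < U₁ ∧ ∀ δ ∈ Set.Icc a b, ∀ U ∈ Set.Ioo (0 : ℝ) U₁,
        ∀ (L : ℕ) [NeZero L], Even L → s₀ ≤ Δ U * L → Δ U * L ≤ s →
          ∃ (W : Submodule ℂ (Fock (Orb (FermionTorus 2 L)))) (E₀ γ η α β : ℝ),
            W ≤ szSector (2 * ⌊(1 - δ) * (L : ℝ) ^ 2 / 2⌋₊) 0 ∧ 0 < γ ∧ 0 ≤ η ∧ 64 * η ≤ γ ∧
            0 ≤ β ∧ β ≤ α ∧ 4 * c₀ * Δ U ^ 2 * (L : ℝ) ^ 4 ≤ α ∧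
            (∃ φ ∈ szSector (2 * ⌊(1 - δ) * (L : ℝ) ^ 2 / 2⌋₊) 0, star φ ⬝ᵥ φ = 1 ∧
              (star φ ⬝ᵥ hubbardTorus 2 L 1 U *ᵥ φ).re ≤ E₀ + η) ∧
            (∀ w ∈ W, ∀ q ∈ szSector (2 * ⌊(1 - δ) * (L : ℝ) ^ 2 / 2⌋₊) 0,
              (∀ w' ∈ W, star w' ⬝ᵥ q = 0) →
                E₀ * ((star w ⬝ᵥ w).re + (star q ⬝ᵥ q).re) + γ * (star q ⬝ᵥ q).re ≤
                  (star (w + q) ⬝ᵥ hubbardTorus 2 L 1 U *ᵥ (w + q)).re) ∧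
            (∀ w ∈ W, α * (star w ⬝ᵥ w).re ≤
              (star w ⬝ᵥ ((pairField dWaveFormFactor L)ᴴ * pairField dWaveFormFactor L) *ᵥ w).re) ∧
            (∀ w ∈ W, eucNorm (((pairField dWaveFormFactor L)ᴴ * pairField dWaveFormFactor L) *ᵥ w)
              ≤ (α + β) * eucNorm w) := by
  sorry

/-- **`CoherenceWindowLRO_of` — the skeleton theorem**: the stub implies the crux BY NAME through the landed
composition `coherenceWindowLRO_of_gapForms` (sorry-free, p156808). -/
theorem CoherenceWindowLRO_of : CoherenceWindowLRO :=
  coherenceWindowLRO_of_gapForms stub_gapForms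

end Summit.HubbardSuperconductivity.HubbardSuperconductivity.Cruxes.CoherenceWindowLRO.KatoWindow
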